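import Summits.QuantumFields.BalabanUV.Beta.EriceFlowEnclosureB12AsPrintedPointwiseFadingEventualAF
import Literature.MathematicalPhysics.QuantumFieldTheory.Balaban1983to89.T4ContinuumCoupling

/-!
# Beta / EriceFlowEnclosureB12AsPrintedPointwiseFadingEventualAFEnd — WHAT (0.31) FORCES, part 10c: node U2's FULL CONTINUUM-RUNNING-COUPLING PACKAGE
# `T4ContinuumCoupling.ContinuumRunning` — INCLUDING the pointwise floor `.lower` on the continuum β-values and the logarithmic bound `.af` — for Theorem 2's rows near zero,
# from the TYPED Theorem 2 + node U2's moduli + NE4, with NO asymptotic-freedom letter assumed (part 10b derives it).  Node U2's END-TO-END booking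
# `continuumRunning_of_runs_eventual` takes: runs of (0.20) in a box ]0, γ] pinned in the infrared, NE4, the history moduli with fading memory, the EVENTUAL AF letter `EventualLowerH b γ k₀ β`
# and the smallness `C_m((k₀+1)γ³ + 2γ∕b) ≤ (1−θ)∕2`.  Part 10b supplies the letter near zero from the typed Theorem 2 with k₀ FIXED BEFORE the box is shrunk, so the smallness is met by
# shrinking the box (§1 `exists_small_box`), the moduli ∕ NE4 ∕ the letter restricting to sub-boxes; the runs are Theorem 2's own rows in the small box (`tunedRuns_of_theorem2Statement`).
# Headlines: **`continuumRunning_smallBox_of_typedTheorem2`** (the package for EVERY pinned family of runs in the small box — node U2's eventual booking is never void near zero on the typed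
# interface) and **`continuumRunning_of_typedTheorem2`** ∕ **`continuumBeta_lower_of_typedTheorem2`** (Theorem 2's OWN rows «g₀(ε, g)»: the continuum running coupling `gstar` with limit
# flow, geometric tail, **`bstar m ≥ b > 0` at every physical scale** and **`gstar m ≤ (1∕g_IR² + b·m)^{−1∕2}`**).  bflow-p1 #64a∕#64b obtained convergence ∕ flow ∕ tail ∕ AF-on-average floor-FREE
# in a BIG box through a (0.31)-reference family and recorded «`ContinuumRunning.lower` NOT obtained»; here the pointwise floor IS obtained, in a small box, from the same letters + the typed
# Theorem 2 — complementary bookings (β-flow team, prover 2 = lower ∕ positivity side, unit `b2b-balaban-beta-bflow-p2`, gen 46; ROW AP-I × node U2's `T4ContinuumCoupling`)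

HONEST FRAMING (page 1 of everything the β sub-cell writes): discharging `BetaPertH` makes Bałaban's UV stability UNCONDITIONAL — a
real constructive-QFT result; it is NOT the continuum limit and NOT the Clay problem.  HONEST DEPENDENCY (cell reorg 2026-08-19,
verbatim): «continuum YM on T⁴ ⇐ BetaPertH ∧ nine spine estimates (0/9 proved); BetaPertH ⇐ (D1) ∧ (D4) ∧ CAP+tail; G-an2-4 gates
asym, D1 and NE2/3/4.»  THIS MODULE DISCHARGES NOTHING: bookkeeping BY NAME over node U2's Literature `T4ContinuumCoupling.continuumRunning_of_runs_eventual` ∕ `ContinuumRunning` (consumed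
verbatim, nothing restated or modified), part 10b, and the NAMED FIELDS of the statement-exact typing `B12BetaAsPrinted` of [Balaban1987RG1] = T. Bałaban, Commun. Math. Phys. **109** (1987)
(`Theorem2Statement` — STATED WITHOUT PROOF in print, p. 259 — a HYPOTHESIS; `Step.InInterval`, the run family `S.cpl`), under LETTERS displayed as hypotheses: prover 1's binder `hrg` ∕ (U),
node U2's `HistLipschitz ∕ FadingMemory ∕ ScaleShiftRate` (NOT printed; GAPS G-t4-U2-1 ∕ -2).  «Continuum running coupling» = the K → ∞ limit of the effective couplings of (0.20) at fixed
physical scale (`T4ContinuumCoupling.gstar`), NOT the continuum limit of the measures, NOT a spine estimate.  Nothing of Bałaban's objects is asserted.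

WHAT THIS FILE PROVES (0 sorry, 0 def):
§1 `histLipschitz_of_le`, `scaleShiftRate_of_le`, `eventualLowerH_of_le` (restriction to sub-boxes), `exists_small_box` (a box below node U2's smallness with k₀ fixed).
§2 **`continuumRunning_smallBox_of_typedTheorem2`** (∃ b > 0 ∀ γ₀ > 0 ∃ δ′ ∈ ]0, min(γ_U, γ₀)]: `ContinuumRunning S.β g g_IR δ′ b` for EVERY pinned family of runs in ]0, δ′]).
§3 **`continuumRunning_of_typedTheorem2`** (Theorem 2's own rows at every torus exponent m, endpoints g_IR ≤ g₃), **`continuumBeta_lower_of_typedTheorem2`** (`.lower` and `.af` displayed),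
   `continuumRunning_of_typedTheorem2'` (`hrg` discharged from `Definitions` + (U)).
NOT CLAIMED: any letter for Bałaban's β; the continuum limit of the measures; which reading print intends; Theorem 2; `BetaPertH`; Clay.
-/

namespace Summit.QuantumFields.BalabanUV.Beta.EriceFlowEnclosureB12AsPrintedPointwiseFadingEventualAFEnd

open Finset
open Literature.MathematicalPhysics.QuantumFieldTheory.Balaban1983to89
open Literature.MathematicalPhysics.QuantumFieldTheory.Balaban1983to89.B12BetaAsPrinted
open Literature.MathematicalPhysics.QuantumFieldTheory.Balaban1983to89.FlowStep (HBeta prefixOf Box mem_box box_mono RGEqH BetaUpperH)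
open Literature.MathematicalPhysics.QuantumFieldTheory.Balaban1983to89.T4CouplingMatching (HistLipschitz FadingMemory ScaleShiftRate
  EventualLowerH)
open Literature.MathematicalPhysics.QuantumFieldTheory.Balaban1983to89.T4ContinuumCoupling (ContinuumRunning continuumRunning_of_runs_eventual
  gstar bstar)
open Summit.QuantumFields.BalabanUV.Beta.EriceFlowEnclosureB12AsPrintedUpper (tunedRuns_of_theorem2Statement)
open Summit.QuantumFields.BalabanUV.Beta.EriceFlowEnclosureB12AsPrintedTunedUpper (hrg_of_betaUpperH)
open Summit.QuantumFields.BalabanUV.Beta.EriceFlowEnclosureB12AsPrintedPointwiseFadingDrift (runs_of_theorem2)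
open Summit.QuantumFields.BalabanUV.Beta.EriceFlowEnclosureB12AsPrintedPointwiseFadingEventualAF

noncomputable section

/-! ## §1 Restricting the letters to a smaller box; a box small enough for node U2's smallness condition -/

/-- The history moduli restrict to a smaller box. [folklore] -/
theorem histLipschitz_of_le {β : HBeta} {Λ : ℕ → ℕ → ℝ} {γ δ : ℝ} (h : HistLipschitz Λ γ β) (hδγ : δ ≤ γ) : HistLipschitz Λ δ β :=
  fun k p q hp hq => h k p q (box_mono hδγ k hp) (box_mono hδγ k hq)

/-- NE4 restricts to a smaller box. [folklore] -/
theorem scaleShiftRate_of_le {β : HBeta} {c θ γ δ : ℝ} (h : ScaleShiftRate c θ γ β) (hδγ : δ ≤ γ) : ScaleShiftRate c θ δ β :=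
  fun k w hw => h k w (box_mono hδγ (k + 1) hw)

/-- The eventual letter restricts to a smaller box (cf. `T4FlagMemoryAF.eventualLowerH_mono`; restated inline to keep the import light). [folklore] -/
theorem eventualLowerH_of_le {β : HBeta} {b γ δ : ℝ} {k₀ : ℕ} (h : EventualLowerH b γ k₀ β) (hδγ : δ ≤ γ) : EventualLowerH b δ k₀ β :=
  fun k v hk hv => h k v hk (box_mono hδγ k hv)

/-- **A box below every threshold.**  For b > 0, 0 ≤ C_m, θ < 1, any k₀ and any two positive caps δ, γ₀ there is `0 < δ′ ≤ min(δ, γ₀)` with node U2's smallness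
`C_m((k₀+1)δ′³ + 2δ′∕b) ≤ (1−θ)∕2` (take δ′ ≤ 1, so δ′³ ≤ δ′, and δ′ ≤ (1−θ)∕(2(C_m+1)(k₀+1+2∕b))). [folklore] -/
theorem exists_small_box {b Cm θ δ γ₀ : ℝ} {k₀ : ℕ} (hb : 0 < b) (hCm : 0 ≤ Cm) (hθ1 : θ < 1) (hδ : 0 < δ) (hγ₀ : 0 < γ₀) :
    ∃ δ' : ℝ, 0 < δ' ∧ δ' ≤ δ ∧ δ' ≤ γ₀ ∧ Cm * (((k₀ : ℝ) + 1) * δ' ^ 3 + 2 * δ' / b) ≤ (1 - θ) / 2 := by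
  have h1θ : 0 < 1 - θ := by linarith
  set Q : ℝ := (k₀ : ℝ) + 1 + 2 / b with hQ
  have hQ0 : 0 < Q := by rw [hQ]; positivity
  set δ' : ℝ := min (min δ γ₀) (min 1 ((1 - θ) / (2 * (Cm + 1) * Q))) with hδ'
  have hδ'pos : 0 < δ' := lt_min (lt_min hδ hγ₀) (lt_min one_pos (by positivity))
  have hδ'δ : δ' ≤ δ := (min_le_left _ _).trans (min_le_left _ _)
  have hδ'γ : δ' ≤ γ₀ := (min_le_left _ _).trans (min_le_right _ _)
  have hδ'1 : δ' ≤ 1 := (min_le_right _ _).trans (min_le_left _ _)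
  have hδ'q : δ' ≤ (1 - θ) / (2 * (Cm + 1) * Q) := (min_le_right _ _).trans (min_le_right _ _)
  refine ⟨δ', hδ'pos, hδ'δ, hδ'γ, ?_⟩
  have hcube : δ' ^ 3 ≤ δ' := by
    have : δ' ^ 3 = δ' * (δ' * δ') := by ring
    rw [this]
    have h2 : δ' * δ' ≤ 1 := by nlinarith
    nlinarith
  have hlin : ((k₀ : ℝ) + 1) * δ' ^ 3 + 2 * δ' / b ≤ Q * δ' := by
    have : Q * δ' = ((k₀ : ℝ) + 1) * δ' + 2 * δ' / b := by rw [hQ]; ring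
    rw [this]
    have hk : 0 ≤ (k₀ : ℝ) + 1 := by positivity
    nlinarith [mul_le_mul_of_nonneg_left hcube hk]
  have hmain : (Cm + 1) * (Q * δ') ≤ (1 - θ) / 2 := by
    have h := mul_le_mul_of_nonneg_left hδ'q (show 0 ≤ (Cm + 1) * Q by positivity)
    calc (Cm + 1) * (Q * δ') = (Cm + 1) * Q * δ' := by ring
      _ ≤ (Cm + 1) * Q * ((1 - θ) / (2 * (Cm + 1) * Q)) := h
      _ = (1 - θ) / 2 := by field_simp
  calc Cm * (((k₀ : ℝ) + 1) * δ' ^ 3 + 2 * δ' / b) ≤ Cm * (Q * δ') := mul_le_mul_of_nonneg_left hlin hCm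
    _ ≤ (Cm + 1) * (Q * δ') := by nlinarith [mul_nonneg hQ0.le hδ'pos.le]
    _ ≤ (1 - θ) / 2 := hmain

/-! ## §2 Node U2's package for EVERY pinned family of rows in a small box, from the typed Theorem 2 -/

variable {S : Setting}

/-- **NODE U2's EVENTUAL BOOKING IS NEVER VOID NEAR ZERO ON THE TYPED INTERFACE.**  `Theorem2Statement S hL` AS TYPED + prover 1's binder `hrg` on ]0, γ_U] + `HistLipschitz Λ γ_U S.β` with
`FadingMemory C_m θ Λ` + `ScaleShiftRate c θ γ_U S.β` (0 < θ < 1; 0 ≤ C_m, c) ⟹ there are a floor b > 0 and, below EVERY cap γ₀ > 0, a box size `0 < δ′ ≤ min(γ_U, γ₀)` such that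
node U2's `T4ContinuumCoupling.continuumRunning_of_runs_eventual` applies to EVERY family of runs of (0.20) in ]0, δ′] pinned at a common infrared value g_IR: the FULL package
`ContinuumRunning S.β g g_IR δ′ b` — convergence at every physical scale, the limit flow, the geometric tail, `gstar 0 = g_IR`, AND the pointwise floor **`b ≤ bstar g m`** on the continuum β-values
with the logarithmic bound **`gstar g m ≤ (1∕g_IR² + b·m)^{−1∕2}`** (`.lower`, `.af`).  The eventual AF letter it consumes is part 10b's `eventualLowerH_of_theorem2_fadingMemory_NE4` (a
CONSEQUENCE of the typed (0.31) under the same moduli + NE4), the box is shrunk below node U2's smallness `C_m((k₀+1)δ′³ + 2δ′∕b) ≤ (1−θ)∕2` AFTER k₀ is fixed (`exists_small_box`).  Compare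
bflow-p1's #64a∕#64b (floor-FREE route through a (0.31)-reference family: convergence, flow, tail, two-sided running with an end-anchored defect, AF on average — «what replaces
`ContinuumRunning.lower`, which is NOT obtained»): here `.lower` IS obtained, near zero. [cite: Balaban1987RG1, Thm 2 (0.31) p.259 with (0.20) p.256, §1 p.264 and §5 p.298] -/
theorem continuumRunning_smallBox_of_typedTheorem2 {hL : Odd S.L ∧ 1 < S.L} (hT : Theorem2Statement S hL)
    {γU Cm c θ : ℝ} {Λ : ℕ → ℕ → ℝ} (hγU : 0 < γU) (hθ0 : 0 < θ) (hθ1 : θ < 1) (hCm : 0 ≤ Cm) (hc : 0 ≤ c)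
    (hrg : ∀ P : B12.RunParams, Step.InInterval γU P.K (S.cpl P) → RGEqH P.K S.β (S.cpl P))
    (hLip : HistLipschitz Λ γU S.β) (hΛ : FadingMemory Cm θ Λ) (hS : ScaleShiftRate c θ γU S.β) :
    ∃ b : ℝ, 0 < b ∧ ∀ γ₀ : ℝ, 0 < γ₀ → ∃ δ' : ℝ, 0 < δ' ∧ δ' ≤ γU ∧ δ' ≤ γ₀ ∧
      ∀ (g : ℕ → ℕ → ℝ) (gIR : ℝ), (∀ K, RGEqH K S.β (g K)) → (∀ K i, i ≤ K → 0 < g K i ∧ g K i ≤ δ') → (∀ K, g K K = gIR) →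
        ContinuumRunning S.β g gIR δ' b := by
  obtain ⟨b, hb, δ, hδ, hδγ, k₀, hlo⟩ := eventualLowerH_of_theorem2_fadingMemory_NE4 hT hγU hθ0.le hθ1 hCm hrg hLip hΛ hS
  refine ⟨b, hb, fun γ₀ hγ₀ => ?_⟩
  obtain ⟨δ', hδ'pos, hδ'δ, hδ'γ₀, hsmall⟩ := exists_small_box (k₀ := k₀) hb hCm hθ1 hδ hγ₀
  have hδ'U : δ' ≤ γU := hδ'δ.trans hδγ
  refine ⟨δ', hδ'pos, hδ'U, hδ'γ₀, fun g gIR hrun hbox hpin => ?_⟩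
  exact continuumRunning_of_runs_eventual g gIR hδ'pos hb hθ0 hθ1 hc hCm hrun hbox hpin
    (scaleShiftRate_of_le hS hδ'U) (histLipschitz_of_le hLip hδ'U) hΛ (eventualLowerH_of_le hlo hδ'δ) hsmall

/-! ## §3 Theorem 2's OWN rows «g₀ = g₀(ε, g)»: the continuum running coupling with its pointwise-AF continuum β-function -/

/-- **THE CONTINUUM RUNNING COUPLING OF THEOREM 2's ROWS, WITH THE POINTWISE FLOOR ON ITS β-VALUES, FROM THE TYPED THEOREM 2 + node U2's MODULI + NE4 ALONE.**  Same hypotheses ⟹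
there is a floor b > 0 and, for every torus exponent m, a box `0 < δ′ ≤ γ_U` and a threshold g₃ > 0 such that for EVERY renormalized coupling `g_IR ∈ ]0, g₃]` Theorem 2's tuned bare couplings
«g₀ = g₀(ε, g_IR)» (one per cutoff ε = L^{−K}, `…B12AsPrintedUpper.tunedRuns_of_theorem2Statement` at the box δ′) give rows (K, m, g₀ K) in ]0, δ′] pinned at g_IR carrying node U2's FULL package
`ContinuumRunning S.β (rows) g_IR δ′ b`: the effective couplings converge at every physical scale to `gstar`, `gstar 0 = g_IR`, the limit flow `1∕gstar(m′+1)² = 1∕gstar(m′)² + bstar m′` holds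
with **`bstar m′ ≥ b > 0` at EVERY physical scale** (THE CONTINUUM β-FUNCTION OF THEOREM 2's LIMIT IS POINTWISE ASYMPTOTICALLY FREE) and **`gstar m′ ≤ (1∕g_IR² + b·m′)^{−1∕2}`**, plus the
geometric tail.  No AF letter, no sign, no floor, no `Definitions` assumed. [cite: Balaban1987RG1, Thm 2 (0.31) p.259 with (0.20) p.256, §1 p.264 and §5 p.298] -/
theorem continuumRunning_of_typedTheorem2 {hL : Odd S.L ∧ 1 < S.L} (hT : Theorem2Statement S hL)
    {γU Cm c θ : ℝ} {Λ : ℕ → ℕ → ℝ} (hγU : 0 < γU) (hθ0 : 0 < θ) (hθ1 : θ < 1) (hCm : 0 ≤ Cm) (hc : 0 ≤ c)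
    (hrg : ∀ P : B12.RunParams, Step.InInterval γU P.K (S.cpl P) → RGEqH P.K S.β (S.cpl P))
    (hLip : HistLipschitz Λ γU S.β) (hΛ : FadingMemory Cm θ Λ) (hS : ScaleShiftRate c θ γU S.β) :
    ∃ b : ℝ, 0 < b ∧ ∀ m : ℕ, ∃ δ' g₃ : ℝ, 0 < δ' ∧ δ' ≤ γU ∧ 0 < g₃ ∧ g₃ ≤ δ' ∧ ∀ gIR : ℝ, 0 < gIR → gIR ≤ g₃ →
      ∃ g₀ : ℕ → ℝ, (∀ K, Step.InInterval δ' K (S.cpl ⟨K, m, g₀ K⟩)) ∧ (∀ K, S.cpl ⟨K, m, g₀ K⟩ K = gIR) ∧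
        ContinuumRunning S.β (fun K => S.cpl ⟨K, m, g₀ K⟩) gIR δ' b := by
  obtain ⟨b, hb, hall⟩ := continuumRunning_smallBox_of_typedTheorem2 hT hγU hθ0 hθ1 hCm hc hrg hLip hΛ hS
  refine ⟨b, hb, fun m => ?_⟩
  -- Theorem 2's box threshold at this torus exponent
  obtain ⟨γ₀, hγ₀, hγ⟩ := tunedRuns_of_theorem2Statement hT m
  obtain ⟨δ', hδ'pos, hδ'U, hδ'γ₀, hpkg⟩ := hall γ₀ hγ₀
  obtain ⟨g₁, hg₁, hg⟩ := hγ δ' hδ'pos hδ'γ₀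
  refine ⟨δ', min g₁ δ', hδ'pos, hδ'U, lt_min hg₁ hδ'pos, min_le_right _ _, fun gIR hgIR hle => ?_⟩
  obtain ⟨β, β', -, -, hK⟩ := hg gIR hgIR (hle.trans (min_le_left _ _))
  choose g₀ hI hend _h031 using hK
  refine ⟨g₀, hI, hend, hpkg (fun K => S.cpl ⟨K, m, g₀ K⟩) gIR (fun K => ?_) (fun K i hi => hI K i hi) hend⟩
  exact hrg ⟨K, m, g₀ K⟩ fun i hi => ⟨(hI K i hi).1, (hI K i hi).2.trans hδ'U⟩

/-- **READ-OUT: the continuum β-function of Theorem 2's limit is pointwise AF and the continuum running coupling is logarithmically asymptotically free** — the two fields `.lower` and `.af` of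
the package, displayed. [cite: Balaban1987RG1, Thm 2 (0.31) p.259 with (0.20) p.256 and §5 p.298] -/
theorem continuumBeta_lower_of_typedTheorem2 {hL : Odd S.L ∧ 1 < S.L} (hT : Theorem2Statement S hL)
    {γU Cm c θ : ℝ} {Λ : ℕ → ℕ → ℝ} (hγU : 0 < γU) (hθ0 : 0 < θ) (hθ1 : θ < 1) (hCm : 0 ≤ Cm) (hc : 0 ≤ c)
    (hrg : ∀ P : B12.RunParams, Step.InInterval γU P.K (S.cpl P) → RGEqH P.K S.β (S.cpl P))
    (hLip : HistLipschitz Λ γU S.β) (hΛ : FadingMemory Cm θ Λ) (hS : ScaleShiftRate c θ γU S.β) :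
    ∃ b : ℝ, 0 < b ∧ ∀ m : ℕ, ∃ g₃ : ℝ, 0 < g₃ ∧ ∀ gIR : ℝ, 0 < gIR → gIR ≤ g₃ →
      ∃ g₀ : ℕ → ℝ, (∀ K, S.cpl ⟨K, m, g₀ K⟩ K = gIR) ∧
        (∀ m', b ≤ bstar (fun K => S.cpl ⟨K, m, g₀ K⟩) m') ∧
        (∀ m', gstar (fun K => S.cpl ⟨K, m, g₀ K⟩) m' ≤ 1 / T4CouplingMatching.sprof gIR b m') := by
  obtain ⟨b, hb, hall⟩ := continuumRunning_of_typedTheorem2 hT hγU hθ0 hθ1 hCm hc hrg hLip hΛ hS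
  refine ⟨b, hb, fun m => ?_⟩
  obtain ⟨δ', g₃, -, -, hg₃, -, hrows⟩ := hall m
  refine ⟨g₃, hg₃, fun gIR hgIR hle => ?_⟩
  obtain ⟨g₀, -, hend, hCR⟩ := hrows gIR hgIR hle
  exact ⟨g₀, hend, hCR.lower, hCR.af⟩

/-- The same END with prover 1's binder `hrg` DISCHARGED from the printed `Definitions` and the upper letter (U) with Mγ_U² < 1. [cite: Balaban1987RG1, Thm 2 (0.31) p.259 with §1 p.264] -/
theorem continuumRunning_of_typedTheorem2' {hL : Odd S.L ∧ 1 < S.L} (hT : Theorem2Statement S hL) (hDef : Definitions S)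
    {γU Cm c θ M : ℝ} {Λ : ℕ → ℕ → ℝ} (hγU : 0 < γU) (hθ0 : 0 < θ) (hθ1 : θ < 1) (hCm : 0 ≤ Cm) (hc : 0 ≤ c)
    (hub : BetaUpperH M γU S.β) (hMγ : M * γU ^ 2 < 1)
    (hLip : HistLipschitz Λ γU S.β) (hΛ : FadingMemory Cm θ Λ) (hS : ScaleShiftRate c θ γU S.β) :
    ∃ b : ℝ, 0 < b ∧ ∀ m : ℕ, ∃ δ' g₃ : ℝ, 0 < δ' ∧ δ' ≤ γU ∧ 0 < g₃ ∧ g₃ ≤ δ' ∧ ∀ gIR : ℝ, 0 < gIR → gIR ≤ g₃ →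
      ∃ g₀ : ℕ → ℝ, (∀ K, Step.InInterval δ' K (S.cpl ⟨K, m, g₀ K⟩)) ∧ (∀ K, S.cpl ⟨K, m, g₀ K⟩ K = gIR) ∧
        ContinuumRunning S.β (fun K => S.cpl ⟨K, m, g₀ K⟩) gIR δ' b :=
  continuumRunning_of_typedTheorem2 hT hγU hθ0 hθ1 hCm hc (hrg_of_betaUpperH hDef hγU hub hMγ) hLip hΛ hS

end

end Summit.QuantumFields.BalabanUV.Beta.EriceFlowEnclosureB12AsPrintedPointwiseFadingEventualAFEnd
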